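import Summits.QuantumAdvantage.QuantumAdvantage.Theorems.HintDialAutomaton

/-!
# HintDialLeakLaw — module 4/10 of the HintDial THEOREMS package (cell decomp-qadv, lens-3 generation 6)

§4b: the level-≤2 LEAK LAW for the separated linear-key Maiorana–McFarland class (`W_blTable`, `isDualOf_blTable`, `dual_at_zero`, `dual_lin2`, `dual_cross`, `leak_level1`, `leak_level2`).

Provenance: split of the farm-checked single file `HintDialTheorems.lean` (HOME/decomp-qadv-lens-3/g6/tree/; rc 0 · no proof holes ·
axioms ⊆ {propext, Classical.choice, Quot.sound}); mathematical record: HOME/decomp-qadv-lens-3/g6/NODE-g6.md.  Modules in order: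
HintDialDuality → HintDialLevels → HintDialAutomaton → HintDialLeakLaw → HintDialPlanting → HintDialClosure → HintDialTable → HintDialLowDegree → HintDialAnfLadder → HintDialCovariance (each imports its predecessor).  Namespace `Summit.QuantumAdvantage.QuantumAdvantage.Theorems.HintDial`.
-/

set_option linter.dupNamespace false

noncomputable section

namespace Summit.QuantumAdvantage.QuantumAdvantage.Theorems.HintDial

open Finset
open Literature.Computability.Complexity
open Literature.Computability.QuantumComplexity
open Literature.Computability.MetaComplexity
open _root_.Computability (encodeNat)
namespace Automaton

open CubicForm (bit)
open DerivativeWalsh (W)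
open BuzetChailloux (bxor zeroVec)

/-! ### ★★ NEW (g6): THE LEVEL-≤2 LEAK LAW for the whole SEPARATED LINEAR-KEY MAIORANA–McFARLAND CLASS

Every planting used in this lineage (g2–g5 and §4 below) is a two-sided table `F = blTable k c α M β`, i.e.
`F(x′,x″) = c ⊕ ⟨α,x′⟩ ⊕ ⟨x′, M x″⟩ ⊕ ⟨β,x″⟩` with an invertible `0/1` key matrix `M` (inverse pattern `N`).  Its dual is
`F̃(y′,y″) = c ⊕ ⟨β,u⟩ ⊕ ⟨u,y″⟩,  u = N(α ⊕ y′)` [Mesnager 2016, Prop. 7.1.14; Carlet 2020, §6.1.15], and we PROVE (kernel) the two leak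
identities, stated SEMANTICALLY for the dual function `g` (so they hold for every table representing it):
* `leak_level1`:  `g(0) = c ⊕ ⊕_b β_b·(g(e″_b) ⊕ g(0))` — the dual bit is a degree-2 polynomial in `F`'s bits and the dual's LINEAR
  coefficients (revealed at hint level 1);
* `leak_level2`:  `g(0) = c ⊕ ⊕_{a,b} β_b·α_a·D_{a,b}g(0)` with `D_{a,b}g(0) = g(e′_a ⊕ e″_b) ⊕ g(e′_a) ⊕ g(e″_b) ⊕ g(0)` the cross second
  derivative = the ANF coefficient of `y′_a y″_b` (an XOR of six positional-degree-2 table entries, revealed at hint level 2).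
CONSEQUENCE (the planting law, now a theorem for this class): no family inside the separated linear-key MM class can witness `W2` or
`RungA` — at levels `≤ 2` its answer is an explicit constant-degree `𝔽₂`-polynomial of revealed instance bits, hence in `AC⁰[⊕] ∩ P`
on those instances.  A witness for the characteristic-2 cells must leave the class (quadratic keys / hidden mixing). -/

section LeakLaw

variable {k : ℕ}

/-- HintDial helper `mv_bxor` (lens-3 g6 HintDial THEOREMS package; see the enclosing section docstring). -/
theorem mv_bxor (M : Fin k → Fin k → Bool) (x y : Fin k → Bool) : mv M (bxor x y) = bxor (mv M x) (mv M y) :=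
  funext fun a => bd_bxor_right (M a) x y

/-- HintDial helper `bd_zeroVec_right` (lens-3 g6 HintDial THEOREMS package; see the enclosing section docstring). -/
theorem bd_zeroVec_right (u : Fin k → Bool) : bd u zeroVec = false := by
  simp [bd, zeroVec]

/-- HintDial helper `mv_sgl_apply` (lens-3 g6 HintDial THEOREMS package; see the enclosing section docstring). -/
theorem mv_sgl_apply (N : Fin k → Fin k → Bool) (a b : Fin k) : mv N (sgl a) b = N b a := bd_sgl_right (N b) a

/-- HintDial helper `bxor_left_eq_iff'` (lens-3 g6 HintDial THEOREMS package; see the enclosing section docstring). -/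
theorem bxor_left_eq_iff' (a x y : Fin k → Bool) : bxor a x = y ↔ x = bxor a y := by
  constructor
  · rintro rfl; funext i; show x i = xor (a i) (xor (a i) (x i)); cases a i <;> simp
  · rintro rfl; funext i; show xor (a i) (xor (a i) (y i)) = y i; cases a i <;> simp

variable {c : Bool} {α β : Fin k → Bool} {M N : Fin k → Fin k → Bool}

/-- `N` is a right inverse pattern of the key `M` (`M·N = 1` on vectors); on the finite space this makes `x ↦ Mx` bijective. -/
theorem mv_injective (hN : ∀ x, mv M (mv N x) = x) : Function.Injective (mv M) :=
  Finite.injective_iff_surjective.2 fun t => ⟨mv N t, hN t⟩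

/-- HintDial helper `mv_eq_iff` (lens-3 g6 HintDial THEOREMS package; see the enclosing section docstring). -/
theorem mv_eq_iff (hN : ∀ x, mv M (mv N x) = x) (x t : Fin k → Bool) : mv M x = t ↔ x = mv N t :=
  ⟨fun h => mv_injective hN (by rw [h, hN]), fun h => by rw [h, hN]⟩

/-- ★ the Maiorana–McFarland dual of `blTable k c α M β` (key inverse `N`): `F̃(y′,y″) = c ⊕ ⟨β,u⟩ ⊕ ⟨u,y″⟩`, `u = N(α ⊕ y′)`. -/
def dualFn (c : Bool) (α : Fin k → Bool) (N : Fin k → Fin k → Bool) (β : Fin k → Bool) (y : Fin (k + k) → Bool) : Bool :=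
  xor (xor c (bd β (mv N (bxor α fun i => y (Fin.castAdd k i)))))
    (bd (mv N (bxor α fun i => y (Fin.castAdd k i))) fun i => y (Fin.natAdd k i))

/-- HintDial helper `dualFn_append` (lens-3 g6 HintDial THEOREMS package; see the enclosing section docstring). -/
theorem dualFn_append (y₁ y₂ : Fin k → Bool) :
    dualFn c α N β (Fin.append y₁ y₂) = xor (xor c (bd β (mv N (bxor α y₁)))) (bd (mv N (bxor α y₁)) y₂) := by
  simp only [dualFn, Fin.append_left, Fin.append_right]

/-- ★ THE WALSH TRANSFORM of a general two-sided table with invertible key. -/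
theorem W_blTable (hN : ∀ x, mv M (mv N x) = x) (y₁ y₂ : Fin k → Bool) :
    W (fun x => signOf ((blTable k c α M β).eval x)) (Fin.append y₁ y₂)
      = 2 ^ k * (signOf c * twist β (mv N (bxor α y₁)) * twist (mv N (bxor α y₁)) y₂) := by
  rw [DerivativeWalsh.W, sum_append]
  simp_rw [eval_blTable, twist_append, signOf_xor, signOf_bd]
  rw [sum_comm]
  have inner : ∀ x₂ : Fin k → Bool,
      ∑ x₁ : Fin k → Bool, signOf c * twist α x₁ * twist x₁ (mv M x₂) * twist β x₂ * (twist x₁ y₁ * twist x₂ y₂)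
        = (signOf c * twist β x₂ * twist x₂ y₂) * (if x₂ = mv N (bxor α y₁) then (2 : ℝ) ^ k else 0) := by
    intro x₂
    have e : ∀ x₁ : Fin k → Bool, signOf c * twist α x₁ * twist x₁ (mv M x₂) * twist β x₂ * (twist x₁ y₁ * twist x₂ y₂)
        = (signOf c * twist β x₂ * twist x₂ y₂) * twist x₁ (bxor (bxor α (mv M x₂)) y₁) := fun x₁ => by
      rw [Literature.Computability.QuantumComplexity.BuzetChailloux.twist_bxor_right, Literature.Computability.QuantumComplexity.BuzetChailloux.twist_bxor_right, twist_comm α x₁]; ring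
    simp_rw [e]
    rw [← mul_sum, BuzetChailloux.sum_twist_left]
    simp only [BuzetChailloux.bxor_eq_zeroVec_iff]
    simp only [bxor_left_eq_iff', mv_eq_iff hN]
  simp_rw [inner, mul_ite, mul_zero, Finset.sum_ite_eq', Finset.mem_univ, if_true]
  ring

/-- ★★ `dualFn` IS the dual of the two-sided table (for every right-inverse pattern `N` of the key). -/
theorem isDualOf_blTable (hN : ∀ x, mv M (mv N x) = x) : IsDualOf (blTable k c α M β).eval (dualFn c α N β) := by
  intro y
  obtain ⟨⟨y₁, y₂⟩, rfl⟩ := (Fin.appendEquiv k k).surjective y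
  show W _ (Fin.append y₁ y₂) = _ * signOf (dualFn c α N β (Fin.append y₁ y₂))
  rw [W_blTable hN, dualFn_append]
  simp only [signOf_xor, signOf_bd]
  rw [SgnForrMem.sqrt_two_pow_add_self]

/-- uniqueness of the dual, in `IsDualOf` form -/
theorem isDualOf_unique {n : ℕ} {f g g' : (Fin n → Bool) → Bool} (h : IsDualOf f g) (h' : IsDualOf f g') : g = g' := by
  funext y
  have e := h y
  rw [h' y] at e
  exact (signOf_injective (mul_left_cancel₀ (by positivity) e)).symm

/-- the probe points: `0`, `e′_a`, `e″_b`, `e′_a ⊕ e″_b` -/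
def pt0 : Fin (k + k) → Bool := Fin.append zeroVec zeroVec
/-- HintDial helper `pt1` (lens-3 g6 HintDial THEOREMS package; see the enclosing section docstring). -/
def pt1 (a : Fin k) : Fin (k + k) → Bool := Fin.append (sgl a) zeroVec
/-- HintDial helper `pt2` (lens-3 g6 HintDial THEOREMS package; see the enclosing section docstring). -/
def pt2 (b : Fin k) : Fin (k + k) → Bool := Fin.append zeroVec (sgl b)
/-- HintDial helper `pt12` (lens-3 g6 HintDial THEOREMS package; see the enclosing section docstring). -/
def pt12 (a b : Fin k) : Fin (k + k) → Bool := Fin.append (sgl a) (sgl b)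

/-- the value of the dual bit: `F̃(0) = c ⊕ ⟨β, Nα⟩` -/
theorem dual_at_zero (hN : ∀ x, mv M (mv N x) = x) {g : (Fin (k + k) → Bool) → Bool}
    (hg : IsDualOf (blTable k c α M β).eval g) : g pt0 = xor c (bd β (mv N α)) := by
  obtain rfl := isDualOf_unique (isDualOf_blTable (c := c) (α := α) (β := β) hN) hg
  rw [pt0, dualFn_append, BuzetChailloux.bxor_zeroVec, bd_zeroVec_right, Bool.xor_false]

/-- the dual's linear coefficient of `y″_b` (revealed at hint level 1) is `(Nα)_b` -/
theorem dual_lin2 (hN : ∀ x, mv M (mv N x) = x) {g : (Fin (k + k) → Bool) → Bool}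
    (hg : IsDualOf (blTable k c α M β).eval g) (b : Fin k) : xor (g (pt2 b)) (g pt0) = mv N α b := by
  obtain rfl := isDualOf_unique (isDualOf_blTable (c := c) (α := α) (β := β) hN) hg
  rw [pt0, pt2, dualFn_append, dualFn_append, BuzetChailloux.bxor_zeroVec, bd_zeroVec_right, bd_sgl_right, Bool.xor_false]
  generalize xor c (bd β (mv N α)) = P
  cases P <;> simp

/-- the dual's cross coefficient of `y′_a y″_b` (revealed at hint level 2) is the key-inverse entry `N_{b,a}` -/
theorem dual_cross (hN : ∀ x, mv M (mv N x) = x) {g : (Fin (k + k) → Bool) → Bool}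
    (hg : IsDualOf (blTable k c α M β).eval g) (a b : Fin k) :
    xor (xor (g (pt12 a b)) (g (pt1 a))) (xor (g (pt2 b)) (g pt0)) = N b a := by
  obtain rfl := isDualOf_unique (isDualOf_blTable (c := c) (α := α) (β := β) hN) hg
  rw [pt0, pt1, pt2, pt12, dualFn_append, dualFn_append, dualFn_append, dualFn_append, BuzetChailloux.bxor_zeroVec,
    bd_zeroVec_right, bd_zeroVec_right, bd_sgl_right, bd_sgl_right, mv_bxor, bd_bxor_right, ← mv_sgl_apply N a b]
  generalize bd β (mv N α) = P
  generalize bd β (mv N (sgl a)) = Q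
  generalize hR : mv N α = R
  generalize hS : mv N (sgl a) = S
  show xor (xor (xor (xor c (xor P Q)) (xor (R b) (S b))) (xor (xor c (xor P Q)) false)) (xor (xor (xor c P) (R b)) (xor (xor c P) false)) = S b
  generalize R b = r
  generalize S b = s
  cases c <;> cases P <;> cases Q <;> cases r <;> cases s <;> rfl

/-- ★★ LEAK LAW, LEVEL 1: the dual bit is a degree-2 polynomial of level-1-visible data
(`c`, `β` from `F`; the dual's linear coefficients `g(e″_b) ⊕ g(0)`). -/
theorem leak_level1 (hN : ∀ x, mv M (mv N x) = x) {g : (Fin (k + k) → Bool) → Bool}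
    (hg : IsDualOf (blTable k c α M β).eval g) : g pt0 = xor c (bd β fun b => xor (g (pt2 b)) (g pt0)) := by
  have h : (fun b => xor (g (pt2 b)) (g pt0)) = mv N α := funext fun b => dual_lin2 hN hg b
  rw [h, dual_at_zero hN hg]

/-- ★★ LEAK LAW, LEVEL 2: the dual bit is a degree-3 polynomial of level-2-visible data
(`c`, `α`, `β` from `F`; the dual's cross second derivatives `D_{a,b} g(0)`, i.e. its `y′_a y″_b` ANF coefficients). -/
theorem leak_level2 (hN : ∀ x, mv M (mv N x) = x) {g : (Fin (k + k) → Bool) → Bool}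
    (hg : IsDualOf (blTable k c α M β).eval g) :
    g pt0 = xor c (bd β fun b => bd (fun a => xor (xor (g (pt12 a b)) (g (pt1 a))) (xor (g (pt2 b)) (g pt0))) α) := by
  have h : (fun b => bd (fun a => xor (xor (g (pt12 a b)) (g (pt1 a))) (xor (g (pt2 b)) (g pt0))) α) = mv N α :=
    funext fun b => by
      have : (fun a => xor (xor (g (pt12 a b)) (g (pt1 a))) (xor (g (pt2 b)) (g pt0))) = N b := funext fun a => dual_cross hN hg a b
      rw [this]; rfl
  rw [h, dual_at_zero hN hg]

end LeakLaw

end Automaton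

end Summit.QuantumAdvantage.QuantumAdvantage.Theorems.HintDial

end
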